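import Summits.CriticalPhenomena.PercolationContinuityZ3.Theorems.PercNearOneGluingNoHeavyLowerTailSunflowerLeafLeafFreeExchange
import HarnessLib

/-!
# `NoHeavyLowerTail` (crux stmt-CriticalPhenomena-4575), abstract sunflower cubic: `FreeFour` — the CAPPED case (a column resource
# `x_k = 1`, i.e. a petal containing `{z₂ open}`), analytically

Support file (seat `prim-ineq-prove-1` gen 67; `--supports stmt-CriticalPhenomena-4575`).  No `sorry`, no named facts, no new
definitions.  Memo: run/shared/lean/prim/prim-ineq-prove-1/FINDING-FREEFOUR-prove1-g67.md §4.3.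

The set-level `z₂`-petal theorem (`…SunflowerLeafLeafZTwo`) has the analytic core `LeafLeafZ.zTwo_endgame` with two inputs: (I1) the
`C`-safety budget of all `z₂`-closed values and (I2) the relative Lemma A for the others.  Inside `FreeFour` both inputs are
THEOREMS of the tree: (I1) is the capped pendant lemma at `V = 1` (`cappedPendant_holds`) for the data `(y_j; (1−s)e_j+sg_j,
(1−s)f_j+sh_j)`, and (I2) is `res0_leafLeaf` ((RES0′) with the leaf-leaf constant), once the column budget has forced every other
column resource to its floor (`x_j = (1−σ)e_j+σf_j = (1−σ)α₀₀+σα₁₀`).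
* `exists_row_split` — an aggregate row value `Y ∈ [(1−s)α₀₀ + s·g, 1]` splits as `(1−s)y′ + s·k′` with `α₀₀ ≤ y′ ≤ 1`, `g ≤ k′ ≤ 1`
  (the dictionary of `res0_leafLeaf` wants the two cells);
* `prod_erase_le_pow` — dropping a member from a Lemma-A budget;
* **`freeFour_of_xCap`** — the conclusion of `FreeFour` for every admissible family with some `x_k = 1`;
* **`freeFour_of_yCap`** — the mirror statement (`y_k = 1`).
Hence `FreeFourCore` (`…SunflowerLeafLeafFreeExchange`) reduces to the families with no capped free resource: at most one `y` and at
most one `x` strictly above its link, everything else base (memo §5).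
-/

noncomputable section

namespace Summit.CriticalPhenomena.PercolationContinuityZ3.Theorems.SunflowerPartition

namespace SafeCalc

namespace LeafLeafZ

open Finset LinkedCurrency

/-- Splitting an aggregate row value into two cells above given floors. [this work] -/
theorem exists_row_split {s α g Y : ℝ} (hs0 : 0 ≤ s) (hs1 : s ≤ 1) (hα1 : α ≤ 1) (hg1 : g ≤ 1)
    (hlo : (1 - s) * α + s * g ≤ Y) (hhi : Y ≤ 1) :
    ∃ y' k' : ℝ, α ≤ y' ∧ y' ≤ 1 ∧ g ≤ k' ∧ k' ≤ 1 ∧ (1 - s) * y' + s * k' = Y := by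
  by_cases hY : Y ≤ (1 - s) * α + s
  · -- raise `k'` only
    rcases eq_or_lt_of_le hs0 with hs | hs
    · refine ⟨Y, 1, ?_, hhi, hg1, le_rfl, by rw [← hs]; ring⟩
      rw [← hs] at hlo; linarith
    · refine ⟨α, (Y - (1 - s) * α) / s, le_rfl, hα1, ?_, ?_, ?_⟩
      · rw [le_div_iff₀ hs]; linarith
      · rw [div_le_iff₀ hs]; linarith
      · field_simp; ring
  · -- `k' = 1`, raise `y'`
    rw [not_le] at hY
    have hs' : 0 < 1 - s := by
      by_contra h
      have h1 : s = 1 := le_antisymm hs1 (by linarith)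
      rw [h1] at hY; linarith
    refine ⟨(Y - s) / (1 - s), 1, ?_, ?_, hg1, le_rfl, ?_⟩
    · rw [le_div_iff₀ hs']; linarith
    · rw [div_le_iff₀ hs']; linarith
    · field_simp; ring

/-- Dropping the member `k` (whose value is at least the floor `m > 0`) from a Lemma-A budget. [this work] -/
theorem prod_erase_le_pow {n : ℕ} {v : Fin n → ℝ} {m : ℝ} (hm : 0 < m) (hv : ∀ j, m ≤ v j) (k : Fin n)
    (hB : ∏ j, v j ≤ m ^ (n - 1)) : ∏ j ∈ univ.erase k, v j ≤ m ^ (n - 2) := by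
  classical
  have hP0 : 0 ≤ ∏ j ∈ univ.erase k, v j := prod_nonneg fun j _ => hm.le.trans (hv j)
  have h1 : m * ∏ j ∈ univ.erase k, v j ≤ m ^ (n - 1) := by
    rw [← mul_prod_erase univ v (mem_univ k)] at hB
    exact (mul_le_mul_of_nonneg_right (hv k) hP0).trans hB
  rcases Nat.lt_or_ge n 2 with hn | hn
  · -- `n = 1`: the erased product is empty
    have hk := k.isLt
    have hn1 : n = 1 := by omega
    subst hn1
    have he : univ.erase k = ∅ :=
      eq_empty_iff_forall_notMem.2 fun j hj => (mem_erase.1 hj).1 (Fin.ext (by have := j.isLt; omega))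
    rw [he, prod_empty]; simp
  · have h2 : m ^ (n - 1) = m * m ^ (n - 2) := by rw [← pow_succ']; congr 1; omega
    rw [h2] at h1
    exact le_of_mul_le_mul_left h1 hm

/-- **`FreeFour` with a capped column resource.**  Coins in `[0,1]`, floors `0 < α₀₀ ≤ α₀₁, α₁₀ ≤ α₁₁ ≤ 1`; an admissible family
(the hypotheses of `FreeFour` that are needed) with `x_k = 1` for some `k` satisfies the conclusion of
`FreeFour`.  Proof: the column budget forces `x_j = (1−σ)α₀₀+σα₁₀` for `j ≠ k`; then `zTwo_endgame` with (I1) = `cappedPendant_holds`,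
(I2) = `res0_leafLeaf`. [this work] -/
theorem freeFour_of_xCap {σ s τ t α00 α01 α10 α11 : ℝ} (hσ0 : 0 ≤ σ) (hσ1 : σ ≤ 1) (hs0 : 0 ≤ s) (hs1 : s ≤ 1)
    (hτ0 : 0 ≤ τ) (hτ1 : τ ≤ 1) (ht0 : 0 ≤ t) (ht1 : t ≤ 1) (hα : 0 < α00) (h01 : α00 ≤ α01) (h10 : α00 ≤ α10)
    (h0111 : α01 ≤ α11) (h1011 : α10 ≤ α11) (h11 : α11 ≤ 1)
    {n : ℕ} (e g f h y x : Fin n → ℝ)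
    (he : ∀ j, α00 ≤ e j) (hg : ∀ j, α01 ≤ g j) (hf : ∀ j, α10 ≤ f j) (hh : ∀ j, α11 ≤ h j) (hh1 : ∀ j, h j ≤ 1)
    (lef : ∀ j, e j ≤ f j) (lgh : ∀ j, g j ≤ h j) (lfh : ∀ j, f j ≤ h j)
    (ly : ∀ j, (1 - s) * e j + s * g j ≤ y j) (hy1 : ∀ j, y j ≤ 1) (lx : ∀ j, (1 - σ) * e j + σ * f j ≤ x j)
    (Bh : ∏ j, h j ≤ α11 ^ (n - 1))
    (Br1 : ∏ j, ((1 - s) * f j + s * h j) ≤ ((1 - s) * α10 + s * α11) ^ (n - 1))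
    (Bc1 : ∏ j, ((1 - σ) * g j + σ * h j) ≤ ((1 - σ) * α01 + σ * α11) ^ (n - 1))
    (BA : ∏ j, ((1 - σ) * ((1 - s) * e j + s * g j) + σ * ((1 - s) * f j + s * h j)) ≤
      ((1 - σ) * ((1 - s) * α00 + s * α01) + σ * ((1 - s) * α10 + s * α11)) ^ (n - 1))
    (By : ∏ j, y j ≤ ((1 - s) * α00 + s * α01) ^ (n - 1))
    (Bx : ∏ j, x j ≤ ((1 - σ) * α00 + σ * α10) ^ (n - 1))
    (k : Fin n) (hxk : x k = 1) :
    ∏ j, (τ * t + τ * (1 - t) * σ + (1 - τ) * t * s + τ * (1 - t) * (1 - σ) * y j + (1 - τ) * t * (1 - s) * x j +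
        (1 - τ) * (1 - t) * ((1 - σ) * ((1 - s) * e j + s * g j) + σ * ((1 - s) * f j + s * h j))) ≤
      (τ * t + τ * (1 - t) * σ + (1 - τ) * t * s + τ * (1 - t) * (1 - σ) * ((1 - s) * α00 + s * α01) +
        (1 - τ) * t * (1 - s) * ((1 - σ) * α00 + σ * α10) +
        (1 - τ) * (1 - t) * ((1 - σ) * ((1 - s) * α00 + s * α01) + σ * ((1 - s) * α10 + s * α11))) ^ (n - 1) := by
  classical
  have hσ' : 0 ≤ 1 - σ := sub_nonneg.2 hσ1
  have hs' : 0 ≤ 1 - s := sub_nonneg.2 hs1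
  have hτ' : 0 ≤ 1 - τ := sub_nonneg.2 hτ1
  have hα01_1 : α01 ≤ 1 := h0111.trans h11
  have hα10_1 : α10 ≤ 1 := h1011.trans h11
  have hα00_1 : α00 ≤ 1 := h01.trans hα01_1
  -- floors of the derived quantities
  set b : ℝ := (1 - s) * α00 + s * α01 with hb
  set β : ℝ := (1 - s) * α10 + s * α11 with hβ
  set c : ℝ := (1 - σ) * α00 + σ * α10 with hc
  set c1 : ℝ := (1 - σ) * α01 + σ * α11 with hc1
  set gv : ℝ := τ * (σ + (1 - σ) * b) + (1 - τ) * ((1 - σ) * b + σ * β) with hgv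
  set av : ℝ := τ + (1 - τ) * (s + (1 - s) * c) with hav
  have hb0 : 0 < b := by
    have k1 := mul_nonneg hs0 (sub_nonneg.2 h01)
    have e1 : b = α00 + s * (α01 - α00) := by rw [hb]; ring
    rw [e1]; linarith
  have hbβ : b ≤ β := by
    have k1 := mul_nonneg hs' (sub_nonneg.2 h10)
    have k2 := mul_nonneg hs0 (sub_nonneg.2 h0111)
    have e1 : β - b = (1 - s) * (α10 - α00) + s * (α11 - α01) := by rw [hb, hβ]; ring
    linarith
  have hβ1 : β ≤ 1 := by
    have k1 := mul_le_mul_of_nonneg_left hα10_1 hs'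
    have k2 := mul_le_mul_of_nonneg_left h11 hs0
    rw [hβ]; linarith
  have hc0 : 0 < c := by
    have k1 := mul_nonneg hσ0 (sub_nonneg.2 h10)
    have e1 : c = α00 + σ * (α10 - α00) := by rw [hc]; ring
    rw [e1]; linarith
  have hc10 : 0 < c1 := by
    have k1 := mul_nonneg hσ0 (sub_nonneg.2 h0111)
    have e1 : c1 = α01 + σ * (α11 - α01) := by rw [hc1]; ring
    rw [e1]; linarith
  have hα11 : 0 < α11 := hα.trans_le (h01.trans h0111)
  have h3 : σ + (1 - σ) * b ≤ 1 := by
    have k1 := mul_le_mul_of_nonneg_left (hbβ.trans hβ1) hσ'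
    linarith
  have hgv0 : 0 < gv := by
    have k0 : σ * β ≤ σ * 1 := mul_le_mul_of_nonneg_left hβ1 hσ0
    have k1 : 0 ≤ τ * (σ + (1 - σ) * b - ((1 - σ) * b + σ * β)) := mul_nonneg hτ0 (by linarith)
    have k2 : 0 ≤ σ * (β - b) := mul_nonneg hσ0 (sub_nonneg.2 hbβ)
    have e1 : gv = b + σ * (β - b) + τ * (σ + (1 - σ) * b - ((1 - σ) * b + σ * β)) := by rw [hgv]; ring
    rw [e1]; linarith
  have hga : gv ≤ av := by
    have h2 : c1 ≤ 1 := by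
      have k1 := mul_le_mul_of_nonneg_left hα01_1 hσ'
      have k2 := mul_le_mul_of_nonneg_left h11 hσ0
      rw [hc1]; linarith
    have k1 : 0 ≤ τ * (1 - (σ + (1 - σ) * b)) := mul_nonneg hτ0 (sub_nonneg.2 h3)
    have k2 : 0 ≤ (1 - τ) * s * (1 - c1) := mul_nonneg (mul_nonneg hτ' hs0) (sub_nonneg.2 h2)
    have e1 : av - gv = τ * (1 - (σ + (1 - σ) * b)) + (1 - τ) * s * (1 - c1) := by rw [hav, hgv, hb, hβ, hc, hc1]; ring
    linarith
  -- elementary facts on the cells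
  have hr0b : ∀ j, b ≤ (1 - s) * e j + s * g j := fun j => by
    have k1 := mul_le_mul_of_nonneg_left (he j) hs'
    have k2 := mul_le_mul_of_nonneg_left (hg j) hs0
    rw [hb]; linarith
  have hr1β : ∀ j, β ≤ (1 - s) * f j + s * h j := fun j => by
    have k1 := mul_le_mul_of_nonneg_left (hf j) hs'
    have k2 := mul_le_mul_of_nonneg_left (hh j) hs0
    rw [hβ]; linarith
  have hr1_1 : ∀ j, (1 - s) * f j + s * h j ≤ 1 := fun j => by
    have k1 := mul_le_mul_of_nonneg_left ((lfh j).trans (hh1 j)) hs'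
    have k2 := mul_le_mul_of_nonneg_left (hh1 j) hs0
    linarith
  have hr01 : ∀ j, (1 - s) * e j + s * g j ≤ (1 - s) * f j + s * h j := fun j => by
    have k1 := mul_le_mul_of_nonneg_left (lef j) hs'
    have k2 := mul_le_mul_of_nonneg_left (lgh j) hs0
    linarith
  have hc0c : ∀ j, c ≤ (1 - σ) * e j + σ * f j := fun j => by
    have k1 := mul_le_mul_of_nonneg_left (he j) hσ'
    have k2 := mul_le_mul_of_nonneg_left (hf j) hσ0
    rw [hc]; linarith
  have hc1c : ∀ j, c1 ≤ (1 - σ) * g j + σ * h j := fun j => by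
    have k1 := mul_le_mul_of_nonneg_left (hg j) hσ'
    have k2 := mul_le_mul_of_nonneg_left (hh j) hσ0
    rw [hc1]; linarith
  have hy0 : ∀ j, 0 ≤ y j := fun j => (hb0.le.trans (hr0b j)).trans (ly j)
  -- the `z₂`-closed values
  set l : Fin n → ℝ := fun j => τ * (σ + (1 - σ) * y j) +
    (1 - τ) * ((1 - σ) * ((1 - s) * e j + s * g j) + σ * ((1 - s) * f j + s * h j)) with hl
  have hlg : ∀ j, gv ≤ l j := fun j => by
    have k1 : 0 ≤ τ * (1 - σ) * (y j - b) := mul_nonneg (mul_nonneg hτ0 hσ') (sub_nonneg.2 ((hr0b j).trans (ly j)))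
    have k2 : 0 ≤ (1 - τ) * ((1 - σ) * ((1 - s) * e j + s * g j - b) + σ * ((1 - s) * f j + s * h j - β)) :=
      mul_nonneg hτ' (add_nonneg (mul_nonneg hσ' (sub_nonneg.2 (hr0b j))) (mul_nonneg hσ0 (sub_nonneg.2 (hr1β j))))
    have e1 : l j - gv = τ * (1 - σ) * (y j - b) +
        (1 - τ) * ((1 - σ) * ((1 - s) * e j + s * g j - b) + σ * ((1 - s) * f j + s * h j - β)) := by
      simp only [hl]; rw [hgv]; ring
    linarith
  -- Step A: the column budget forces the other columns to the floor
  have hxc : ∀ j, j ≠ k → x j = c := by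
    intro j hj
    refine le_antisymm ?_ ((hc0c j).trans (lx j))
    have hxge : ∀ i, c ≤ x i := fun i => (hc0c i).trans (lx i)
    have hmem : j ∈ univ.erase k := mem_erase.2 ⟨hj, mem_univ j⟩
    have h1 : ∏ i ∈ univ.erase k, x i ≤ c ^ (n - 1) := by
      rw [← mul_prod_erase univ x (mem_univ k), hxk, one_mul, hc] at Bx; rw [hc]; exact Bx
    rw [← mul_prod_erase _ x hmem] at h1
    have hP : c ^ ((univ.erase k).erase j).card ≤ ∏ i ∈ (univ.erase k).erase j, x i := by
      rw [← prod_const]; exact prod_le_prod (fun i _ => hc0.le) fun i _ => hxge i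
    have hcard : ((univ.erase k).erase j).card = n - 2 := by
      rw [card_erase_of_mem hmem, card_erase_of_mem (mem_univ k), card_univ, Fintype.card_fin, Nat.sub_sub]
    rw [hcard] at hP
    have hn2 : n - 1 = (n - 2) + 1 := by
      have : 2 ≤ n := by
        have h2 : 1 < (univ : Finset (Fin n)).card := one_lt_card.2 ⟨j, mem_univ j, k, mem_univ k, hj⟩
        rwa [card_univ, Fintype.card_fin] at h2
      omega
    have h2 : x j * c ^ (n - 2) ≤ c * c ^ (n - 2) := by
      calc x j * c ^ (n - 2) ≤ x j * ∏ i ∈ (univ.erase k).erase j, x i :=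
            mul_le_mul_of_nonneg_left hP (hc0.le.trans (hxge j))
        _ ≤ c ^ (n - 1) := h1
        _ = c * c ^ (n - 2) := by rw [hn2, pow_succ']
    exact le_of_mul_le_mul_right h2 (pow_pos hc0 _)
  have hc0j : ∀ j, j ≠ k → (1 - σ) * e j + σ * f j = c := fun j hj =>
    le_antisymm (by rw [← hxc j hj]; exact lx j) (hc0c j)
  -- (I1): all `z₂`-closed values, by the capped pendant lemma at `V = 1`
  have hI1 : l k * ∏ j ∈ univ.erase k, l j ≤ gv ^ (univ.erase k).card := by
    rw [mul_prod_erase univ l (mem_univ k), card_erase_of_mem (mem_univ k), card_univ, Fintype.card_fin]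
    have key := cappedPendant_holds (s := σ) (t := τ) (b := b) (β := β) (V := 1) hb0 hbβ hβ1 hσ0 hσ1 hτ0 hτ1 n y
      (fun j => (1 - s) * f j + s * h j) (fun j => (1 - s) * e j + s * g j)
      (fun j => (hr0b j).trans (ly j)) hy1 hr1β hr1_1 hr0b ly hr01
      (by rw [hb]; exact By) (by rw [hβ, mul_one]; exact Br1) (by rw [hb, hβ, mul_one]; exact BA)
    have e1 : ∀ j, σ * τ + σ * (1 - τ) * ((1 - s) * f j + s * h j) + (1 - σ) * τ * y j +
        (1 - σ) * (1 - τ) * ((1 - s) * e j + s * g j) = l j := fun j => by simp only [hl]; ring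
    have e2 : (σ * τ + σ * (1 - τ) * β + (1 - σ) * b) ^ (n - 1) * (τ + (1 - τ) * 1) = gv ^ (n - 1) := by
      rw [hgv]; ring
    rw [← e2, ← prod_congr rfl fun j _ => e1 j]; exact key
  -- (I2): the others are inside `T`: (RES0′) with the leaf-leaf constant
  have hI2 : (univ.erase k).Nonempty → ∏ j ∈ univ.erase k, l j ≤ av * gv ^ ((univ.erase k).card - 1) := by
    intro hJ
    -- split the aggregate row values
    have hsplit : ∀ j, ∃ y' k' : ℝ, α00 ≤ y' ∧ y' ≤ 1 ∧ g j ≤ k' ∧ k' ≤ 1 ∧ (1 - s) * y' + s * k' = y j := fun j =>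
      exists_row_split hs0 hs1 hα00_1 ((lgh j).trans (hh1 j))
        (le_trans (by have := mul_le_mul_of_nonneg_left (he j) hs'; linarith) (ly j)) (hy1 j)
    choose y' k' hy' hy'1 hk' hk'1 hsum using hsplit
    have key := res0_leafLeaf (τ := τ) (σ := σ) (s := s) (α00 := α00) (α01 := α01) (α10 := α10) (α11 := α11) hτ0 hτ1 hσ0
      hσ1 hs0 hs1 hα.le (by rw [← hb]; exact hb0) h01 h0111 h10 (univ.erase k) hJ y' k' g h
      (fun j _ => hy' j) (fun j _ => hy'1 j) (fun j _ => (hg j).trans (hk' j)) (fun j _ => hk'1 j) (fun j _ => hg j)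
      (fun j _ => hk' j) (fun j _ => lgh j) (fun j _ => hh j) (fun j _ => hh1 j) ?_ ?_ ?_
    · have e1 : ∀ j ∈ univ.erase k, τ * σ + (1 - τ) * (1 - s) * ((1 - σ) * α00 + σ * α10) +
          τ * (1 - σ) * ((1 - s) * y' j + s * k' j) + s * (1 - τ) * ((1 - σ) * g j + σ * h j) = l j := by
        intro j hj
        have hjk : j ≠ k := (mem_erase.1 hj).1
        have e0 : l j = τ * σ + (1 - τ) * (1 - s) * ((1 - σ) * e j + σ * f j) + τ * (1 - σ) * y j +
            s * (1 - τ) * ((1 - σ) * g j + σ * h j) := by simp only [hl]; ring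
        rw [e0, hc0j j hjk, hsum j, hc]
      have e2 : (τ * σ + (1 - τ) * (1 - s) * ((1 - σ) * α00 + σ * α10) + τ * (1 - σ) * ((1 - s) * α00 + s * α01) +
          s * (1 - τ) * ((1 - σ) * α01 + σ * α11)) ^ ((univ.erase k).card - 1) *
          (τ * σ + (1 - τ) * (1 - s) * ((1 - σ) * α00 + σ * α10) + τ * (1 - σ) + s * (1 - τ)) =
          av * gv ^ ((univ.erase k).card - 1) := by rw [hav, hgv, hb, hβ, hc]; ring
      rw [← e2, ← prod_congr rfl e1]; exact key
    · rw [prod_congr rfl fun j _ => hsum j, card_erase_of_mem (mem_univ k), card_univ, Fintype.card_fin, Nat.sub_sub]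
      have := prod_erase_le_pow hb0 (fun j => (hr0b j).trans (ly j)) k (by rw [hb]; exact By)
      rw [hb] at this; exact this
    · rw [card_erase_of_mem (mem_univ k), card_univ, Fintype.card_fin, Nat.sub_sub]
      exact prod_erase_le_pow hα11 hh k Bh
    · rw [card_erase_of_mem (mem_univ k), card_univ, Fintype.card_fin, Nat.sub_sub]
      have := prod_erase_le_pow hc10 hc1c k (by rw [hc1]; exact Bc1)
      rw [hc1] at this; exact this
  -- the endgame
  have hlk0 : 0 ≤ l k := hgv0.le.trans (hlg k)
  have key := zTwo_endgame ht0 ht1 hgv0 hga (univ.erase k) l (fun j _ => hlg j) hlk0 hI1 hI2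
  rw [card_erase_of_mem (mem_univ k), card_univ, Fintype.card_fin] at key
  -- identify the two sides
  have efac : ∀ j, τ * t + τ * (1 - t) * σ + (1 - τ) * t * s + τ * (1 - t) * (1 - σ) * y j + (1 - τ) * t * (1 - s) * x j +
      (1 - τ) * (1 - t) * ((1 - σ) * ((1 - s) * e j + s * g j) + σ * ((1 - s) * f j + s * h j)) =
      t * (τ + (1 - τ) * (s + (1 - s) * x j)) + (1 - t) * l j := fun j => by simp only [hl]; ring
  have eF : t * av + (1 - t) * gv = τ * t + τ * (1 - t) * σ + (1 - τ) * t * s +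
      τ * (1 - t) * (1 - σ) * ((1 - s) * α00 + s * α01) + (1 - τ) * t * (1 - s) * ((1 - σ) * α00 + σ * α10) +
      (1 - τ) * (1 - t) * ((1 - σ) * ((1 - s) * α00 + s * α01) + σ * ((1 - s) * α10 + s * α11)) := by
    rw [hav, hgv, hb, hβ, hc]; ring
  rw [← eF, prod_congr rfl fun j _ => efac j, ← mul_prod_erase univ _ (mem_univ k), hxk]
  have e3 : t * (τ + (1 - τ) * (s + (1 - s) * 1)) + (1 - t) * l k = t + (1 - t) * l k := by ring
  have e4 : ∏ j ∈ univ.erase k, (t * (τ + (1 - τ) * (s + (1 - s) * x j)) + (1 - t) * l j) =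
      ∏ j ∈ univ.erase k, (t * av + (1 - t) * l j) := by
    refine prod_congr rfl fun j hj => ?_
    rw [hxc j (mem_erase.1 hj).1, hav]
  rw [e3, e4]; exact key

/-- **`FreeFour` with a capped row resource** (`y_k = 1`): the mirror image of `freeFour_of_xCap`. [this work] -/
theorem freeFour_of_yCap {σ s τ t α00 α01 α10 α11 : ℝ} (hσ0 : 0 ≤ σ) (hσ1 : σ ≤ 1) (hs0 : 0 ≤ s) (hs1 : s ≤ 1)
    (hτ0 : 0 ≤ τ) (hτ1 : τ ≤ 1) (ht0 : 0 ≤ t) (ht1 : t ≤ 1) (hα : 0 < α00) (h01 : α00 ≤ α01) (h10 : α00 ≤ α10)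
    (h0111 : α01 ≤ α11) (h1011 : α10 ≤ α11) (h11 : α11 ≤ 1)
    {n : ℕ} (e g f h y x : Fin n → ℝ)
    (he : ∀ j, α00 ≤ e j) (hg : ∀ j, α01 ≤ g j) (hf : ∀ j, α10 ≤ f j) (hh : ∀ j, α11 ≤ h j) (hh1 : ∀ j, h j ≤ 1)
    (leg : ∀ j, e j ≤ g j) (lgh : ∀ j, g j ≤ h j) (lfh : ∀ j, f j ≤ h j)
    (ly : ∀ j, (1 - s) * e j + s * g j ≤ y j) (lx : ∀ j, (1 - σ) * e j + σ * f j ≤ x j) (hx1 : ∀ j, x j ≤ 1)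
    (Bh : ∏ j, h j ≤ α11 ^ (n - 1))
    (Br1 : ∏ j, ((1 - s) * f j + s * h j) ≤ ((1 - s) * α10 + s * α11) ^ (n - 1))
    (Bc1 : ∏ j, ((1 - σ) * g j + σ * h j) ≤ ((1 - σ) * α01 + σ * α11) ^ (n - 1))
    (BA : ∏ j, ((1 - σ) * ((1 - s) * e j + s * g j) + σ * ((1 - s) * f j + s * h j)) ≤
      ((1 - σ) * ((1 - s) * α00 + s * α01) + σ * ((1 - s) * α10 + s * α11)) ^ (n - 1))
    (By : ∏ j, y j ≤ ((1 - s) * α00 + s * α01) ^ (n - 1))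
    (Bx : ∏ j, x j ≤ ((1 - σ) * α00 + σ * α10) ^ (n - 1))
    (k : Fin n) (hyk : y k = 1) :
    ∏ j, (τ * t + τ * (1 - t) * σ + (1 - τ) * t * s + τ * (1 - t) * (1 - σ) * y j + (1 - τ) * t * (1 - s) * x j +
        (1 - τ) * (1 - t) * ((1 - σ) * ((1 - s) * e j + s * g j) + σ * ((1 - s) * f j + s * h j))) ≤
      (τ * t + τ * (1 - t) * σ + (1 - τ) * t * s + τ * (1 - t) * (1 - σ) * ((1 - s) * α00 + s * α01) +
        (1 - τ) * t * (1 - s) * ((1 - σ) * α00 + σ * α10) +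
        (1 - τ) * (1 - t) * ((1 - σ) * ((1 - s) * α00 + s * α01) + σ * ((1 - s) * α10 + s * α11))) ^ (n - 1) := by
  have BA' : ∏ j, ((1 - s) * ((1 - σ) * e j + σ * f j) + s * ((1 - σ) * g j + σ * h j)) ≤
      ((1 - s) * ((1 - σ) * α00 + σ * α10) + s * ((1 - σ) * α01 + σ * α11)) ^ (n - 1) := by
    have e1 : ∀ j, (1 - s) * ((1 - σ) * e j + σ * f j) + s * ((1 - σ) * g j + σ * h j) =
        (1 - σ) * ((1 - s) * e j + s * g j) + σ * ((1 - s) * f j + s * h j) := fun j => by ring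
    have e2 : (1 - s) * ((1 - σ) * α00 + σ * α10) + s * ((1 - σ) * α01 + σ * α11) =
        (1 - σ) * ((1 - s) * α00 + s * α01) + σ * ((1 - s) * α10 + s * α11) := by ring
    rw [e2, prod_congr rfl fun j _ => e1 j]; exact BA
  have key := freeFour_of_xCap (σ := s) (s := σ) (τ := t) (t := τ) hs0 hs1 hσ0 hσ1 ht0 ht1 hτ0 hτ1 hα h10 h01 h1011 h0111
    h11 e f g h x y he hf hg hh hh1 leg lfh lgh lx hx1 ly Bh Bc1 Br1 BA' Bx By k hyk
  have e1 : ∀ j, t * τ + t * (1 - τ) * s + (1 - t) * τ * σ + t * (1 - τ) * (1 - s) * x j + (1 - t) * τ * (1 - σ) * y j +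
      (1 - t) * (1 - τ) * ((1 - s) * ((1 - σ) * e j + σ * f j) + s * ((1 - σ) * g j + σ * h j)) =
      τ * t + τ * (1 - t) * σ + (1 - τ) * t * s + τ * (1 - t) * (1 - σ) * y j + (1 - τ) * t * (1 - s) * x j +
        (1 - τ) * (1 - t) * ((1 - σ) * ((1 - s) * e j + s * g j) + σ * ((1 - s) * f j + s * h j)) := fun j => by ring
  have e2 : t * τ + t * (1 - τ) * s + (1 - t) * τ * σ + t * (1 - τ) * (1 - s) * ((1 - σ) * α00 + σ * α10) +
      (1 - t) * τ * (1 - σ) * ((1 - s) * α00 + s * α01) +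
      (1 - t) * (1 - τ) * ((1 - s) * ((1 - σ) * α00 + σ * α10) + s * ((1 - σ) * α01 + σ * α11)) =
      τ * t + τ * (1 - t) * σ + (1 - τ) * t * s + τ * (1 - t) * (1 - σ) * ((1 - s) * α00 + s * α01) +
        (1 - τ) * t * (1 - s) * ((1 - σ) * α00 + σ * α10) +
        (1 - τ) * (1 - t) * ((1 - σ) * ((1 - s) * α00 + s * α01) + σ * ((1 - s) * α10 + s * α11)) := by ring
  rw [← e2, ← prod_congr rfl fun j _ => e1 j]; exact key

end LeafLeafZ

end SafeCalc

end Summit.CriticalPhenomena.PercolationContinuityZ3.Theorems.SunflowerPartition
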